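import Summits.Ventures.LatticeQCDFlow.Scoring.OnePlaquetteBessel
import Mathlib.Analysis.Calculus.ParametricIntervalIntegral
import Mathlib.Analysis.Calculus.Deriv.MeanValue
import HarnessLib

/-!
# The U(1) and SU(2) one-plaquette plaquettes are non-decreasing in `β` (`d⟨cos⟩_β/dβ = Var_β(cos) ≥ 0`); hence the Bessel ratios `I₁/I₀` and `I₂/I₁` are monotone

HONEST FRAMING: exact (Metropolis-corrected) sampling algorithms for lattice gauge theory;
figures of merit are autocorrelation/cost numbers at stated couplings and volumes; no
continuum-physics claim.

Venture `LatticeQCDFlow` (cell pub-lqcd), sub-topic `Scoring`; FANOUT row 5 (`s0-sun-a`), GEN-16.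
NEW WORK of the cell (placement rule): the U(1)/SU(2) twin of GEN-16's `OnePlaquetteSU3FreeEnergy.lean`
(`d⟨plaq⟩_β/dβ = Var ≥ 0` for SU(3)), for GEN-2/7's one-dimensional one-plaquette laws of
`Scoring/SchwingerDysonOnePlaquette.lean` (`onePlaquetteExpect β`, weight `e^{β cos θ}` on `[0,2π]`;
`onePlaquetteExpectSU2 β`, weight `sin²α e^{β cos α}` on `[0,π]`) identified with Bessel ratios in
`Scoring/OnePlaquetteBessel.lean`:

* §1 `hasDerivAt_intervalIntegral_expCosWeight` — dominated differentiation under `∫_a^b` for the weight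
  `g·w·e^{β cos}` (continuous `g, w`): `d/dβ ∫ g w e^{β cos} = ∫ (g cos) w e^{β cos}`;
* §2 U(1): `hasDerivAt_onePlaquetteZ`, **`hasDerivAt_onePlaquetteExpect_cos`**
  (`d⟨cos θ⟩_β/dβ = ⟨cos²θ⟩_β − ⟨cos θ⟩_β²`), `onePlaquetteExpect_cos_sq_le` (variance `≥ 0`),
  **`monotone_onePlaquetteExpect_cos`** and **`monotone_besselI_one_div_besselI_zero`**:
  `β ↦ I₁(β)/I₀(β)` IS MONOTONE ON `ℝ`;
* §3 SU(2): the same for `⟨cos α⟩_β`, **`monotone_onePlaquetteExpectSU2_cos`** and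
  **`monotone_besselI_two_div_besselI_one`**: `β ↦ I₂(β)/I₁(β)` IS MONOTONE ON `ℝ`.

So the three reference-table plaquette oracles (U(1) `I₁/I₀`, SU(2) `I₂/I₁`, SU(3)
`OnePlaquetteSU3FreeEnergy`) are all non-decreasing functions of the coupling, each with derivative the
one-plaquette variance (the cell's 'error-bar oracle' per plaquette).  Classical counterpart (monotonicity
of `I_{ν+1}/I_ν`, e.g. D. E. Amos, Math. Comp. 28 (1974) 239) is NOT cited as a fact: here it is a
consequence of positivity of a variance.  NOT here: strict monotonicity; concavity of the ratios.
Nothing is cited as a fact; no `def`.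
-/

noncomputable section

open Real MeasureTheory Set intervalIntegral
open Literature.Analysis.FunctionSpaces

namespace Summit.Ventures.LatticeQCDFlow.Scoring

/-! ### 1. Differentiating a one-dimensional Wilson-type weight under the integral sign -/

/-- **`d/dβ ∫_a^b g w e^{β cos} = ∫_a^b (g cos) w e^{β cos}`** for continuous `g, w`
(dominated differentiation on `[a, b]`; the majorant is `‖g‖_∞ ‖w‖_∞ e^{|β|+1}` on the unit ball). -/
theorem hasDerivAt_intervalIntegral_expCosWeight {g w : ℝ → ℝ} (hg : Continuous g)
    (hw : Continuous w) (a b β : ℝ) :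
    HasDerivAt (fun c => ∫ x in a..b, g x * (w x * Real.exp (c * Real.cos x)))
      (∫ x in a..b, g x * Real.cos x * (w x * Real.exp (β * Real.cos x))) β := by
  -- bounds for `g` and `w` on the compact interval
  obtain ⟨G, hG⟩ := isCompact_uIcc.exists_bound_of_continuousOn (f := g) (s := uIcc a b)
    hg.continuousOn
  obtain ⟨W, hW⟩ := isCompact_uIcc.exists_bound_of_continuousOn (f := w) (s := uIcc a b)
    hw.continuousOn
  have hG0 : 0 ≤ G := le_trans (norm_nonneg _) (hG a left_mem_uIcc)
  have hW0 : 0 ≤ W := le_trans (norm_nonneg _) (hW a left_mem_uIcc)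
  have h := intervalIntegral.hasDerivAt_integral_of_dominated_loc_of_deriv_le
    (μ := volume) (a := a) (b := b) (x₀ := β)
    (F := fun c x => g x * (w x * Real.exp (c * Real.cos x)))
    (F' := fun c x => g x * Real.cos x * (w x * Real.exp (c * Real.cos x)))
    (bound := fun _ => G * 1 * (W * Real.exp (|β| + 1))) (Metric.ball_mem_nhds β zero_lt_one)
    (Filter.Eventually.of_forall fun c =>
      (by fun_prop : Continuous fun x => g x * (w x * Real.exp (c * Real.cos x))).aestronglyMeasurable)
    ((by fun_prop : Continuous fun x => g x * (w x * Real.exp (β * Real.cos x))).intervalIntegrable _ _)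
    (by fun_prop : Continuous fun x =>
      g x * Real.cos x * (w x * Real.exp (β * Real.cos x))).aestronglyMeasurable ?_
    intervalIntegrable_const ?_
  · exact h.2
  · refine Filter.Eventually.of_forall fun x hx c hc => ?_
    have hx' : x ∈ uIcc a b := uIoc_subset_uIcc hx
    have hc' : |c| ≤ |β| + 1 := by
      have := Metric.mem_ball.mp hc
      rw [Real.dist_eq] at this
      linarith [abs_sub_abs_le_abs_sub c β]
    rw [Real.norm_eq_abs, abs_mul, abs_mul, abs_mul]
    have h1 : |g x| ≤ G := by simpa [Real.norm_eq_abs] using hG x hx'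
    have h2 : |Real.cos x| ≤ 1 := Real.abs_cos_le_one x
    have h3 : |w x| ≤ W := by simpa [Real.norm_eq_abs] using hW x hx'
    have h4 : |Real.exp (c * Real.cos x)| ≤ Real.exp (|β| + 1) := by
      rw [abs_of_pos (Real.exp_pos _)]
      apply Real.exp_le_exp.mpr
      have : |c * Real.cos x| ≤ |c| := by
        rw [abs_mul]; exact mul_le_of_le_one_right (abs_nonneg _) h2
      linarith [le_abs_self (c * Real.cos x)]
    gcongr
  · refine Filter.Eventually.of_forall fun x _ c _ => ?_
    have hd : HasDerivAt (fun c : ℝ => c * Real.cos x) (Real.cos x) c := by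
      simpa using (hasDerivAt_id c).mul_const (Real.cos x)
    have he := ((hd.exp.const_mul (w x)).const_mul (g x))
    refine he.congr_deriv ?_
    ring

/-- The quotient-rule value as "second moment minus square". -/
theorem quotient_rule_variance (S N Z : ℝ) (hZ : Z ≠ 0) :
    (S * Z - N * N) / Z ^ 2 = S / Z - (N / Z) ^ 2 := by
  field_simp

/-! ### 2. U(1): `⟨cos θ⟩_β = I₁(β)/I₀(β)` is non-decreasing -/

/-- `Z'(β) = ∫_0^{2π} cos θ e^{β cos θ} dθ` (the U(1) plaquette numerator). -/
theorem hasDerivAt_onePlaquetteZ (β : ℝ) :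
    HasDerivAt onePlaquetteZ
      (∫ θ in (0 : ℝ)..(2 * π), Real.cos θ * Real.exp (β * Real.cos θ)) β := by
  have h := hasDerivAt_intervalIntegral_expCosWeight (g := fun _ => (1 : ℝ)) (w := fun _ => (1 : ℝ))
    continuous_const continuous_const 0 (2 * π) β
  simp only [one_mul] at h
  exact h

/-- The derivative of the U(1) numerator: `d/dβ ∫ cos θ e^{β cos θ} = ∫ cos² θ e^{β cos θ}`. -/
theorem hasDerivAt_onePlaquette_numerator (β : ℝ) :
    HasDerivAt (fun c => ∫ θ in (0 : ℝ)..(2 * π), Real.cos θ * Real.exp (c * Real.cos θ))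
      (∫ θ in (0 : ℝ)..(2 * π), Real.cos θ * Real.cos θ * Real.exp (β * Real.cos θ)) β := by
  have h := hasDerivAt_intervalIntegral_expCosWeight (g := Real.cos) (w := fun _ => (1 : ℝ))
    Real.continuous_cos continuous_const 0 (2 * π) β
  simp only [one_mul] at h
  exact h

/-- **`d⟨cos θ⟩_β/dβ = ⟨cos² θ⟩_β − ⟨cos θ⟩_β²`** (the U(1) one-plaquette variance). -/
theorem hasDerivAt_onePlaquetteExpect_cos (β : ℝ) :
    HasDerivAt (fun c => onePlaquetteExpect c Real.cos)
      (onePlaquetteExpect β (fun θ => Real.cos θ * Real.cos θ) - onePlaquetteExpect β Real.cos ^ 2) β := by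
  have hne := (onePlaquetteZ_pos β).ne'
  have h := (hasDerivAt_onePlaquette_numerator β).div (hasDerivAt_onePlaquetteZ β) hne
  have hfun : (fun c => onePlaquetteExpect c Real.cos)
      = (fun c => ∫ θ in (0 : ℝ)..(2 * π), Real.cos θ * Real.exp (c * Real.cos θ))
        / onePlaquetteZ := by
    funext c
    simp only [onePlaquetteExpect, Pi.div_apply]
  rw [hfun]
  refine h.congr_deriv ?_
  simp only [onePlaquetteExpect]
  exact quotient_rule_variance _ _ _ hne

/-- The U(1) variance is non-negative: `⟨cos θ⟩_β² ≤ ⟨cos² θ⟩_β`. -/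
theorem onePlaquetteExpect_cos_sq_le (β : ℝ) :
    onePlaquetteExpect β Real.cos ^ 2
      ≤ onePlaquetteExpect β (fun θ => Real.cos θ * Real.cos θ) := by
  have hZ : 0 < onePlaquetteZ β := onePlaquetteZ_pos β
  set N := ∫ θ in (0 : ℝ)..(2 * π), Real.cos θ * Real.exp (β * Real.cos θ) with hN
  set S := ∫ θ in (0 : ℝ)..(2 * π), Real.cos θ * Real.cos θ * Real.exp (β * Real.cos θ) with hS
  set u := N / onePlaquetteZ β with hu
  have hnn : 0 ≤ ∫ θ in (0 : ℝ)..(2 * π), (Real.cos θ - u) ^ 2 * Real.exp (β * Real.cos θ) :=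
    intervalIntegral.integral_nonneg (by positivity) fun θ _ =>
      mul_nonneg (sq_nonneg _) (Real.exp_nonneg _)
  have hpt : ∀ θ : ℝ, (Real.cos θ - u) ^ 2 * Real.exp (β * Real.cos θ)
      = (Real.cos θ * Real.cos θ * Real.exp (β * Real.cos θ)
          - 2 * u * (Real.cos θ * Real.exp (β * Real.cos θ)))
        + u ^ 2 * Real.exp (β * Real.cos θ) := by
    intro θ; ring
  simp_rw [hpt] at hnn
  rw [intervalIntegral.integral_add (Continuous.intervalIntegrable (by fun_prop) _ _)
      (Continuous.intervalIntegrable (by fun_prop) _ _),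
    intervalIntegral.integral_sub (Continuous.intervalIntegrable (by fun_prop) _ _)
      (Continuous.intervalIntegrable (by fun_prop) _ _),
    intervalIntegral.integral_const_mul, intervalIntegral.integral_const_mul, ← hS, ← hN,
    ← onePlaquetteZ] at hnn
  have h1 : S - 2 * u * N + u ^ 2 * onePlaquetteZ β = S - N ^ 2 / onePlaquetteZ β := by
    rw [hu]; field_simp; ring
  have h2 : N ^ 2 ≤ S * onePlaquetteZ β := by
    have : N ^ 2 / onePlaquetteZ β ≤ S := by linarith
    rwa [div_le_iff₀ hZ] at this
  show u ^ 2 ≤ S / onePlaquetteZ β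
  rw [hu, div_pow, div_le_div_iff₀ (pow_pos hZ 2) hZ]
  nlinarith

/-- **The U(1) one-plaquette plaquette `⟨cos θ⟩_β` is non-decreasing in `β`.** -/
theorem monotone_onePlaquetteExpect_cos : Monotone fun β => onePlaquetteExpect β Real.cos := by
  apply monotone_of_deriv_nonneg
  · exact fun β => (hasDerivAt_onePlaquetteExpect_cos β).differentiableAt
  · intro β
    rw [(hasDerivAt_onePlaquetteExpect_cos β).deriv]
    exact sub_nonneg.mpr (onePlaquetteExpect_cos_sq_le β)

/-- **The Bessel ratio `β ↦ I₁(β)/I₀(β)` is monotone on `ℝ`** (it is the U(1) plaquette `⟨cos θ⟩_β`,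
GEN-7's `onePlaquetteExpect_cos_eq_besselI_div`). -/
theorem monotone_besselI_one_div_besselI_zero :
    Monotone fun β : ℝ => besselI 1 β / besselI 0 β := by
  have h : (fun β : ℝ => besselI 1 β / besselI 0 β) = fun β => onePlaquetteExpect β Real.cos :=
    funext fun β => (onePlaquetteExpect_cos_eq_besselI_div β).symm
  rw [h]
  exact monotone_onePlaquetteExpect_cos

/-! ### 3. SU(2): `⟨cos α⟩_β = I₂(β)/I₁(β)` is non-decreasing -/

/-- `Z₂'(β) = ∫_0^π cos α sin²α e^{β cos α} dα`. -/
theorem hasDerivAt_onePlaquetteZSU2 (β : ℝ) :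
    HasDerivAt onePlaquetteZSU2
      (∫ α in (0 : ℝ)..π, Real.cos α * (Real.sin α ^ 2 * Real.exp (β * Real.cos α))) β := by
  have h := hasDerivAt_intervalIntegral_expCosWeight (g := fun _ => (1 : ℝ))
    (w := fun α => Real.sin α ^ 2) continuous_const (by fun_prop) 0 π β
  simp only [one_mul] at h
  exact h

/-- The derivative of the SU(2) numerator. -/
theorem hasDerivAt_onePlaquetteSU2_numerator (β : ℝ) :
    HasDerivAt
      (fun c => ∫ α in (0 : ℝ)..π, Real.cos α * (Real.sin α ^ 2 * Real.exp (c * Real.cos α)))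
      (∫ α in (0 : ℝ)..π, Real.cos α * Real.cos α * (Real.sin α ^ 2 * Real.exp (β * Real.cos α))) β :=
  hasDerivAt_intervalIntegral_expCosWeight (g := Real.cos) (w := fun α => Real.sin α ^ 2)
    Real.continuous_cos (by fun_prop) 0 π β

/-- **`d⟨cos α⟩_β/dβ = ⟨cos² α⟩_β − ⟨cos α⟩_β²`** (the SU(2) one-plaquette variance). -/
theorem hasDerivAt_onePlaquetteExpectSU2_cos (β : ℝ) :
    HasDerivAt (fun c => onePlaquetteExpectSU2 c Real.cos)
      (onePlaquetteExpectSU2 β (fun α => Real.cos α * Real.cos α)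
        - onePlaquetteExpectSU2 β Real.cos ^ 2) β := by
  have hne := (onePlaquetteZSU2_pos β).ne'
  have h := (hasDerivAt_onePlaquetteSU2_numerator β).div (hasDerivAt_onePlaquetteZSU2 β) hne
  have hfun : (fun c => onePlaquetteExpectSU2 c Real.cos)
      = (fun c => ∫ α in (0 : ℝ)..π, Real.cos α * (Real.sin α ^ 2 * Real.exp (c * Real.cos α)))
        / onePlaquetteZSU2 := by
    funext c
    simp only [onePlaquetteExpectSU2, Pi.div_apply]
  rw [hfun]
  refine h.congr_deriv ?_
  simp only [onePlaquetteExpectSU2]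
  exact quotient_rule_variance _ _ _ hne

/-- The SU(2) variance is non-negative: `⟨cos α⟩_β² ≤ ⟨cos² α⟩_β`. -/
theorem onePlaquetteExpectSU2_cos_sq_le (β : ℝ) :
    onePlaquetteExpectSU2 β Real.cos ^ 2
      ≤ onePlaquetteExpectSU2 β (fun α => Real.cos α * Real.cos α) := by
  have hZ : 0 < onePlaquetteZSU2 β := onePlaquetteZSU2_pos β
  set N := ∫ α in (0 : ℝ)..π, Real.cos α * (Real.sin α ^ 2 * Real.exp (β * Real.cos α)) with hN
  set S := ∫ α in (0 : ℝ)..π, Real.cos α * Real.cos α * (Real.sin α ^ 2 * Real.exp (β * Real.cos α))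
    with hS
  set u := N / onePlaquetteZSU2 β with hu
  have hnn : 0 ≤ ∫ α in (0 : ℝ)..π,
      (Real.cos α - u) ^ 2 * (Real.sin α ^ 2 * Real.exp (β * Real.cos α)) :=
    intervalIntegral.integral_nonneg Real.pi_pos.le fun α _ =>
      mul_nonneg (sq_nonneg _) (mul_nonneg (sq_nonneg _) (Real.exp_nonneg _))
  have hpt : ∀ α : ℝ, (Real.cos α - u) ^ 2 * (Real.sin α ^ 2 * Real.exp (β * Real.cos α))
      = (Real.cos α * Real.cos α * (Real.sin α ^ 2 * Real.exp (β * Real.cos α))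
          - 2 * u * (Real.cos α * (Real.sin α ^ 2 * Real.exp (β * Real.cos α))))
        + u ^ 2 * (Real.sin α ^ 2 * Real.exp (β * Real.cos α)) := by
    intro α; ring
  simp_rw [hpt] at hnn
  rw [intervalIntegral.integral_add (Continuous.intervalIntegrable (by fun_prop) _ _)
      (Continuous.intervalIntegrable (by fun_prop) _ _),
    intervalIntegral.integral_sub (Continuous.intervalIntegrable (by fun_prop) _ _)
      (Continuous.intervalIntegrable (by fun_prop) _ _),
    intervalIntegral.integral_const_mul, intervalIntegral.integral_const_mul, ← hS, ← hN,
    ← onePlaquetteZSU2] at hnn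
  have h1 : S - 2 * u * N + u ^ 2 * onePlaquetteZSU2 β = S - N ^ 2 / onePlaquetteZSU2 β := by
    rw [hu]; field_simp; ring
  have h2 : N ^ 2 ≤ S * onePlaquetteZSU2 β := by
    have : N ^ 2 / onePlaquetteZSU2 β ≤ S := by linarith
    rwa [div_le_iff₀ hZ] at this
  show u ^ 2 ≤ S / onePlaquetteZSU2 β
  rw [hu, div_pow, div_le_div_iff₀ (pow_pos hZ 2) hZ]
  nlinarith

/-- **The SU(2) one-plaquette plaquette `⟨cos α⟩_β` is non-decreasing in `β`.** -/
theorem monotone_onePlaquetteExpectSU2_cos :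
    Monotone fun β => onePlaquetteExpectSU2 β Real.cos := by
  apply monotone_of_deriv_nonneg
  · exact fun β => (hasDerivAt_onePlaquetteExpectSU2_cos β).differentiableAt
  · intro β
    rw [(hasDerivAt_onePlaquetteExpectSU2_cos β).deriv]
    exact sub_nonneg.mpr (onePlaquetteExpectSU2_cos_sq_le β)

/-- **The Bessel ratio `β ↦ I₂(β)/I₁(β)` is monotone on `ℝ`** (it is the SU(2) plaquette `⟨cos α⟩_β`,
GEN-7's `onePlaquetteExpectSU2_cos_eq_besselI_div`; at `β = 0` both are `0`). -/
theorem monotone_besselI_two_div_besselI_one : Monotone fun β : ℝ => besselI 2 β / besselI 1 β := by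
  have h : (fun β : ℝ => besselI 2 β / besselI 1 β) = fun β => onePlaquetteExpectSU2 β Real.cos :=
    funext fun β => (onePlaquetteExpectSU2_cos_eq_besselI_div β).symm
  rw [h]
  exact monotone_onePlaquetteExpectSU2_cos

/-! ### 4. Convexity of the free energies and the strong-coupling slopes (appended 2026-08-23, GEN-16) -/

/-- **`log Z` is convex** for the U(1) one-plaquette law (its derivative `⟨cos θ⟩_β` is monotone). -/
theorem convexOn_log_onePlaquetteZ : ConvexOn ℝ Set.univ fun β => Real.log (onePlaquetteZ β) := by
  have hd : ∀ β, HasDerivAt (fun b => Real.log (onePlaquetteZ b)) (onePlaquetteExpect β Real.cos) β :=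
    fun β => by
      refine ((hasDerivAt_onePlaquetteZ β).log (onePlaquetteZ_pos β).ne').congr_deriv ?_
      rw [onePlaquetteExpect]
  refine Monotone.convexOn_univ_of_deriv (fun β => (hd β).differentiableAt) ?_
  rw [show deriv (fun b => Real.log (onePlaquetteZ b)) = fun β => onePlaquetteExpect β Real.cos from
    funext fun β => (hd β).deriv]
  exact monotone_onePlaquetteExpect_cos

/-- **`log Z₂` is convex** for the SU(2) one-plaquette law. -/
theorem convexOn_log_onePlaquetteZSU2 : ConvexOn ℝ Set.univ fun β => Real.log (onePlaquetteZSU2 β) := by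
  have hd : ∀ β, HasDerivAt (fun b => Real.log (onePlaquetteZSU2 b)) (onePlaquetteExpectSU2 β Real.cos) β :=
    fun β => by
      refine ((hasDerivAt_onePlaquetteZSU2 β).log (onePlaquetteZSU2_pos β).ne').congr_deriv ?_
      rw [onePlaquetteExpectSU2]
  refine Monotone.convexOn_univ_of_deriv (fun β => (hd β).differentiableAt) ?_
  rw [show deriv (fun b => Real.log (onePlaquetteZSU2 b)) = fun β => onePlaquetteExpectSU2 β Real.cos from
    funext fun β => (hd β).deriv]
  exact monotone_onePlaquetteExpectSU2_cos

/-- U(1) at `β = 0`: `⟨cos² θ⟩₀ = 1/2`. -/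
theorem onePlaquetteExpect_cos_sq_zero :
    onePlaquetteExpect 0 (fun θ => Real.cos θ * Real.cos θ) = 1 / 2 := by
  have hZ : onePlaquetteZ 0 = 2 * π := by
    rw [onePlaquetteZ_eq_besselI, Literature.Analysis.FunctionSpaces.besselI_zero_apply_zero, mul_one]
  unfold onePlaquetteExpect
  simp only [zero_mul, Real.exp_zero, mul_one, hZ]
  rw [show (fun θ => Real.cos θ * Real.cos θ) = fun θ => Real.cos θ ^ 2 from funext fun θ => by ring,
    integral_cos_sq]
  simp only [Real.cos_zero, Real.sin_zero, mul_zero, sub_zero, Real.sin_two_pi, mul_zero]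
  field_simp
  ring

/-- **THE STRONG-COUPLING SLOPE OF THE U(1) PLAQUETTE IS `1/2`**: `d(I₁/I₀)/dβ |_{β=0} = 1/2`
(`⟨cos θ⟩_β = β/2 + o(β)`). -/
theorem hasDerivAt_onePlaquetteExpect_cos_zero :
    HasDerivAt (fun c => onePlaquetteExpect c Real.cos) (1 / 2) 0 := by
  have h := hasDerivAt_onePlaquetteExpect_cos 0
  rw [onePlaquetteExpect_cos_sq_zero, onePlaquetteExpect_cos_eq_besselI_div, besselI_one_zero,
    zero_div] at h
  simpa using h

/-- SU(2) at `β = 0`: `⟨cos² α⟩₀ = 1/4` (weight `sin² α`). -/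
theorem onePlaquetteExpectSU2_cos_sq_zero :
    onePlaquetteExpectSU2 0 (fun α => Real.cos α * Real.cos α) = 1 / 4 := by
  have hZ : onePlaquetteZSU2 0 = π / 2 := by
    unfold onePlaquetteZSU2
    simp only [zero_mul, Real.exp_zero, mul_one]
    rw [integral_sin_sq]
    simp only [Real.sin_zero, Real.cos_zero, Real.sin_pi, Real.cos_pi, sub_zero, zero_mul]
    ring
  unfold onePlaquetteExpectSU2
  simp only [zero_mul, Real.exp_zero, mul_one, hZ]
  rw [show (fun α => Real.cos α * Real.cos α * Real.sin α ^ 2) = fun α => Real.sin α ^ 2 * Real.cos α ^ 2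
      from funext fun α => by ring, integral_sin_sq_mul_cos_sq]
  simp only [mul_zero, Real.sin_zero, sub_zero, show (4 : ℝ) * π = 2 * π + 2 * π by ring]
  rw [Real.sin_add, Real.sin_two_pi, Real.cos_two_pi]
  have hπ : (π : ℝ) ≠ 0 := Real.pi_ne_zero
  field_simp
  ring

/-- **THE STRONG-COUPLING SLOPE OF THE SU(2) PLAQUETTE IS `1/4`**: `d(I₂/I₁)/dβ |_{β=0} = 1/4`
(`⟨cos α⟩_β = β/4 + o(β)`, i.e. `⟨½ tr U_p⟩ = β_theory2/2 + o(β)` at `b = 2β`). -/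
theorem hasDerivAt_onePlaquetteExpectSU2_cos_zero :
    HasDerivAt (fun c => onePlaquetteExpectSU2 c Real.cos) (1 / 4) 0 := by
  have h := hasDerivAt_onePlaquetteExpectSU2_cos 0
  rw [onePlaquetteExpectSU2_cos_sq_zero, onePlaquetteExpectSU2_cos_eq_besselI_div, besselI_one_zero,
    div_zero] at h
  simpa using h

end Summit.Ventures.LatticeQCDFlow.Scoring
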